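import Mathlib
import HarnessLib

/-!
# Format C: assembly of the diagonal far bound `far Gram ⪰ diag(d̂)` from its five pieces

Route context: Fourier–Galerkin / Schur-complement certificates of Weil positivity on a window ("format C";
cell memo `run/shared/lean/pub/rh-explicit/rh-explicit-weil-10/FORMATC-DESIGN.md` §4.3 / §4.10; supporting
stmt-RiemannHypothesis-0098).  The far-coercivity lemma L-C3a decomposes the sector Gram on the far modes `m > M₁`
as `W = DIAG + PRIME + POLAR_off + DIG_off + EXP_off` and bounds each piece as a quadratic form on every finite
truncation: `DIAG` is diagonal with `DIAG(n,n) ≥ δ_n` (digamma edge bounds D1/D2/D3), `PRIME ⪰ −A·1`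
(path graph: `WeilFormatCPathGraphBound`, `WeilFormatCShiftFormBound`), `POLAR_off ⪰ −ϖ·1` (odd rank-one part; `ϖ = 0`
in the even sector), `|DIG_off| ≤ diag(h)` (Hilbert part: `WeilFormatCHilbertPartBound` / `…LogBound`; plus a
Hilbert–Schmidt ρ-part), `|EXP_off| ≤ ε·1` (Hilbert–Schmidt: `WeilFormatCMatrixNormBounds`).  THIS FILE is the bookkeeping
that turns the five hypotheses into

* `WeilFormatC.farBlock_ge_diag` — **`Σ_n (δ_n − A − ϖ − h_n − ε)·y_n² ≤ Σ_n Σ_m y_n W(n,m) y_m`** for every real `y`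
  on the finite far index set, i.e. `W ⪰ diag(d̂)` with `d̂_n = δ_n − A − ϖ − h_n − ε` — the shape consumed by
  `WeilFormatC.schurStepDiag` (`WeilFormatCSchurStepDiag.lean`, hypothesis "far ⪰ diag d").

Pure `Finset` algebra over an arbitrary finite index set; standard axioms only.  The analytic content is in the
hypotheses; nothing Weil-specific is defined here.
-/

-- `Summit.RiemannHypothesis.RiemannHypothesis.…` is the layout-mandated namespace (summit = problem name).
set_option linter.dupNamespace false

namespace Summit.RiemannHypothesis.RiemannHypothesis.Theorems.WeilFormatC

open Finset

variable {ι : Type*}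

/-- **Assembly of the diagonal far bound.**  On a finite far index set `s`, suppose the sector Gram splits as
`W = D + P + Q + H + E` where: `D` is diagonal with `δ n ≤ D n n`; `P ⪰ −A·1` (`−A Σ y² ≤ yᵀPy`); `Q ⪰ −ϖ·1`;
`|yᵀHy| ≤ Σ h_n y_n²`; `|yᵀEy| ≤ ε Σ y²`.  Then `Σ_n (δ_n − A − ϖ − h_n − ε) y_n² ≤ yᵀWy`. -/
theorem farBlock_ge_diag (s : Finset ι) (W D P Q H E : ι → ι → ℝ) (δ h : ι → ℝ) (A ϖ ε : ℝ)
    (hW : ∀ n ∈ s, ∀ m ∈ s, W n m = D n m + P n m + Q n m + H n m + E n m)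
    (hDoff : ∀ n ∈ s, ∀ m ∈ s, n ≠ m → D n m = 0) (hDdiag : ∀ n ∈ s, δ n ≤ D n n)
    (hP : ∀ y : ι → ℝ, -A * ∑ n ∈ s, y n ^ 2 ≤ (∑ n ∈ s, ∑ m ∈ s, y n * P n m * y m))
    (hQ : ∀ y : ι → ℝ, -ϖ * ∑ n ∈ s, y n ^ 2 ≤ (∑ n ∈ s, ∑ m ∈ s, y n * Q n m * y m))
    (hH : ∀ y : ι → ℝ, |(∑ n ∈ s, ∑ m ∈ s, y n * H n m * y m)| ≤ ∑ n ∈ s, h n * y n ^ 2)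
    (hE : ∀ y : ι → ℝ, |(∑ n ∈ s, ∑ m ∈ s, y n * E n m * y m)| ≤ ε * ∑ n ∈ s, y n ^ 2) (y : ι → ℝ) :
    ∑ n ∈ s, (δ n - A - ϖ - h n - ε) * y n ^ 2 ≤ (∑ n ∈ s, ∑ m ∈ s, y n * W n m * y m) := by
  -- split the form of `W` into the five forms
  have hsplit : (∑ n ∈ s, ∑ m ∈ s, y n * W n m * y m) = (∑ n ∈ s, ∑ m ∈ s, y n * D n m * y m) + (∑ n ∈ s, ∑ m ∈ s, y n * P n m * y m) + (∑ n ∈ s, ∑ m ∈ s, y n * Q n m * y m) + (∑ n ∈ s, ∑ m ∈ s, y n * H n m * y m) + (∑ n ∈ s, ∑ m ∈ s, y n * E n m * y m) := by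
    simp only [← Finset.sum_add_distrib]
    refine Finset.sum_congr rfl fun n hn ↦ Finset.sum_congr rfl fun m hm ↦ ?_
    rw [hW n hn m hm]
    ring
  -- the diagonal part
  have hD : ∑ n ∈ s, δ n * y n ^ 2 ≤ (∑ n ∈ s, ∑ m ∈ s, y n * D n m * y m) := by
    have e : (∑ n ∈ s, ∑ m ∈ s, y n * D n m * y m) = ∑ n ∈ s, D n n * y n ^ 2 := by
      refine Finset.sum_congr rfl fun n hn ↦ ?_
      rw [Finset.sum_eq_single n]
      · ring
      · intro m hm hmn; rw [hDoff n hn m hm (Ne.symm hmn)]; ring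
      · intro h'; exact absurd hn h'
    rw [e]
    exact Finset.sum_le_sum fun n hn ↦ mul_le_mul_of_nonneg_right (hDdiag n hn) (sq_nonneg _)
  have hH' : -(∑ n ∈ s, h n * y n ^ 2) ≤ (∑ n ∈ s, ∑ m ∈ s, y n * H n m * y m) := by
    have := neg_abs_le ((∑ n ∈ s, ∑ m ∈ s, y n * H n m * y m)); linarith [hH y]
  have hE' : -(ε * ∑ n ∈ s, y n ^ 2) ≤ (∑ n ∈ s, ∑ m ∈ s, y n * E n m * y m) := by
    have := neg_abs_le ((∑ n ∈ s, ∑ m ∈ s, y n * E n m * y m)); linarith [hE y]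
  have hlhs : ∑ n ∈ s, (δ n - A - ϖ - h n - ε) * y n ^ 2
      = ∑ n ∈ s, δ n * y n ^ 2 - A * ∑ n ∈ s, y n ^ 2 - ϖ * ∑ n ∈ s, y n ^ 2
        - ∑ n ∈ s, h n * y n ^ 2 - ε * ∑ n ∈ s, y n ^ 2 := by
    simp only [Finset.mul_sum, ← Finset.sum_sub_distrib]
    refine Finset.sum_congr rfl fun n _ ↦ by ring
  rw [hlhs, hsplit]
  linarith [hD, hP y, hQ y, hH', hE']

/-- The same conclusion packaged as "far ⪰ diag d̂" in the exact shape of `schurStepDiag`'s far hypothesis: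
with `d̂ n := δ n − A − ϖ − h n − ε`, `Σ d̂_n y_n² ≤ yᵀ W y`. -/
theorem farBlock_ge_dhat (s : Finset ι) (W D P Q H E : ι → ι → ℝ) (δ h dhat : ι → ℝ)
    (A ϖ ε : ℝ) (hdhat : ∀ n ∈ s, dhat n = δ n - A - ϖ - h n - ε)
    (hW : ∀ n ∈ s, ∀ m ∈ s, W n m = D n m + P n m + Q n m + H n m + E n m)
    (hDoff : ∀ n ∈ s, ∀ m ∈ s, n ≠ m → D n m = 0) (hDdiag : ∀ n ∈ s, δ n ≤ D n n)
    (hP : ∀ y : ι → ℝ, -A * ∑ n ∈ s, y n ^ 2 ≤ (∑ n ∈ s, ∑ m ∈ s, y n * P n m * y m))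
    (hQ : ∀ y : ι → ℝ, -ϖ * ∑ n ∈ s, y n ^ 2 ≤ (∑ n ∈ s, ∑ m ∈ s, y n * Q n m * y m))
    (hH : ∀ y : ι → ℝ, |(∑ n ∈ s, ∑ m ∈ s, y n * H n m * y m)| ≤ ∑ n ∈ s, h n * y n ^ 2)
    (hE : ∀ y : ι → ℝ, |(∑ n ∈ s, ∑ m ∈ s, y n * E n m * y m)| ≤ ε * ∑ n ∈ s, y n ^ 2) (y : ι → ℝ) :
    ∑ n ∈ s, dhat n * y n ^ 2 ≤ (∑ n ∈ s, ∑ m ∈ s, y n * W n m * y m) := by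
  have h := farBlock_ge_diag s W D P Q H E δ h A ϖ ε hW hDoff hDdiag hP hQ hH hE y
  refine le_trans (le_of_eq ?_) h
  exact Finset.sum_congr rfl fun n hn ↦ by rw [hdhat n hn]

end Summit.RiemannHypothesis.RiemannHypothesis.Theorems.WeilFormatC
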